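import Literature.Computability.Cryptography.ChenQuantumLWECrossClassProfile

/-!
# The two-direction law for general measurements (T30: the sharp form behind T19/T20/T29; census §38)

REPRODUCTION / ANALYSIS OF A CLAIMED RESULT UNDER ADJUDICATION (withdrawn): Yilei Chen, *Quantum
Algorithms for Lattice Problems*, IACR ePrint 2024/555, version of 2024-04-18 [ChenQuantumLattice2024]
(the version carrying the author's note that Step 9 contains a bug), Step 9 (§3.5.9, pp. 34–38) acting
on the line kets `|φ_{b,v′}⟩ = Σ_{j ∈ ℤ_P} ψ_P(−j²) |2D²j·b + v′ mod N⟩` (p. 35) of a head-`(−1)`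
direction `b` (the planted vector of eq. (12), p. 17, has this shape), `P = p₁Q` odd, `N = D²P`, and
Chen's unnormalised `QFT` (Lemma 2.12, p. 12).  Bundle `papers/QuantumAdvantage/lwe-quantum-autopsy/`,
Part 2 (`REPAIR-CENSUS.md` §38; theorem **T30**; census row G7), sequel of
`ChenQuantumLWETwoClassLaw.lean` (T19: the two-class law `P_E(s₀) + P_E(s₁) ≤ 1 + 1/#span` INSIDE
Chen's class `b + 2p₁ℤ_Q^U`), `ChenQuantumLWECrossClassProfile.lean` (T20: the datum reader of `b` is
right on every line ket of `b′` with probability exactly `1/#span_Q(b − b′)`) and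
`ChenQuantumLWEClassIsSecretRobust.lean` (T29, whose header lists as NOT proved: "whether every pair of
head-`(−1)` directions in different classes mod `Q` obeys the same law for every POVM").  It answers
REFEREE remark R-74.2 (the one surviving qualification of row G7's prose: the constant-tolerance
statement for a general POVM against a general rival).  HONEST FRAMING: kernel-checked THEOREMS about
measurements of states occurring in a WITHDRAWN algorithm — NOT summit progress, no cryptanalytic
claim in either direction, no new algorithm, no hardness claim; quantum lower bounds are out of scope.

## What is proved

Throughout `P = p₁Q` is odd, `E` is ANY POVM on the Step-8 register `ℂ[ℤ_N^{n+1}]` with outcomes in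
`ℤ_Q` (`POVM`, `ChenQuantumLWEGeneralMeasurement`), and the OFFSET-AVERAGED SUCCESS of `E` on a
direction `β ∈ ℤ^{n+1}` is
`P̄_E(β) = dirSuccess β E = (Σ_u ⟨φ_{β,u}|E_{u₀ mod Q}|φ_{β,u}⟩) / (Σ_u ⟨φ_{β,u}|φ_{β,u}⟩)`,
`u` over ALL of `ℤ_N^{n+1}` (uniformly random offset; every `‖φ_{β,u}‖² = P`): the probability that `E`
outputs the datum `u₀ mod Q` of the line ket it is given.

**1. The law** (`dirSuccess_add_le`; `Shape.dirSuccess_add_le`).  For heads `b₀ = b′₀ = −1` and `2D²p₁`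
a unit mod `Q`:  `P̄_E(b) + P̄_E(b′) ≤ 1 + 1/S`,  `S = #span_Q(b − b′ mod Q)` (a divisor of `Q`,
`= 1` iff `b ≡ b′ (mod Q)`, else `≥ minFac Q ≥ 3`).

**2. Sharpness** (`dirSuccess_datumReader_self`, `dirSuccess_datumReader_cross`,
`dirSuccess_pair_isGreatest`).  Chen's datum reader of `b` (T18) has `P̄ = 1` on `b` and exactly `1/S`
on `b′` (T20), so `1 + 1/S` is the MAXIMUM over all POVMs.

**3. The constant tolerance** (`dirSuccess_le_of_le`, `half_defect_le_eps`,
`eps_floor_of_dirDiffQ_ne_zero`, `not_both_gt_two_thirds`; `Shape.eps_floor_of_dirDiffQ_ne_zero`).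
`(1 − ε)`-success on `b` caps the success on `b′` at `1/S + ε`; `(1 − ε)`-success on both forces
`ε ≥ (1 − 1/S)/2`, hence `ε ≥ (1 − 1/minFac Q)/2 ≥ 1/3` whenever `b ≢ b′ (mod Q)` — for every POVM and
every pair, with no perturbative hypothesis (T29 item 3 needed `4εP² < 1` and gave only pairwise
statements); no POVM beats `2/3` on two inequivalent classes.

**4. Mod-`Q` invariance** (`sum_weight_qft_congr_mod`, `sum_weight_congr_mod`, `dirSuccess_congr_mod`,
`dirSuccess_eq_of_dirDiffQ_eq_zero`).  `P̄_E(β)` depends on `β` only through `β mod Q`, for every POVM —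
although the kets, and even the datum eigenprojectors mod `N`, do not.

## How (a reduction to T19, no new operator theory)

(a) FOURIER BRIDGE (`qftMat`, `POVM.fourierConj`, `POVM.fourierConj_weight`): `F Fᴴ = Fᴴ F = N^{n+1}·1`
for the matrix `F` of `QFT`, so `Ê = N^{−(n+1)} F E Fᴴ` is a POVM with `⟨QFT ψ|Ê_a|QFT ψ⟩ =
N^{n+1}⟨ψ|E_a|ψ⟩`; T19 (stated on `QFT`-side kets) transfers to position-side kets and back.
(b) MOD-`Q` INVARIANCE: expanding `⟨QFT φ_{β,u}|Ê|QFT φ_{β,u}⟩` through the Fourier Gram entries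
(`fourierGram_eq`, T13's module), the sum over the offsets `u` with a fixed datum is the character sum
`T_a(ζ) = Σ_{u₀ ≡ a} ψ_N(u·ζ)`, `ζ = x − y`, which vanishes unless `ζ_i = 0 (i ≠ 0)` and `Qζ₀ = 0`
(`datumCharSum_eq_zero_or`, two translations); on such `ζ` the chirp phases `ψ_P(L_β(y)² − L_β(x)²)` of
congruent directions agree (`chirpPhase_congr_mod`: `L_β̃ = L_β + Q·ρ` and `Q·(L_β(x) − L_β(y)) = 0`).
(c) AVERAGING T19 (`fourier_secret_pair_le`): for each offset `v` apply T19 (`U = {1,…,n}`,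
`bk = b = b̃`) to the relabelled POVM `Ê ∘ (d ↦ (D²p₁)^{−1}(v₀ − d))` (`POVM.map`); each sub-class
member is a line ket at a translated offset whose datum is the relabelled one, so summing over `v` turns
each of T19's sub-class sums into `Q·Q^{n+1}` copies of the offset sum.  (d) Given `b, b′`, take
`b̃ ≡ b (mod Q)` with `b̃₀ = −1`, `p₁ ∣ b̃_i (i ≥ 1)` (`p₁` is a unit mod `Q`) and the secret
`s = (2p₁)^{−1}(b′ − b) mod Q`: then `b̃ + 2p₁s𝟙_U ≡ b′ (mod Q)` and `#span(s|_U) = #span_Q(b − b′)`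
(`inv_card_span_secretDiff_eq`), and (b) moves the law from `(b̃, b̃ + 2p₁s𝟙_U)` to `(b, b′)`.
NUMERICS (not used by Lean; bundle `numerics/b2b-lwe-2/gen32_two_direction_law_check.py`, pure Python):
8 toy cases confirm the commuting block structure behind the law and the value `1 + 1/S` exactly.

## What is NOT here (scope, honestly)

`P̄_E` averages over ALL offsets mod `N`.  T19's finer average over ONE sub-class `K` of offsets (the
class the algorithm's offset actually ranges over, census §0) is available only for pairs inside Chen's
class (T19 itself); for two directions in different classes mod `Q` the sub-class-by-sub-class version
of item 1 is not proved here (the all-offsets average is the mean of the sub-class averages, so item 1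
bounds their mean, not each).  Nothing here bears on reading the datum of ONE direction (T18: certain,
by a measurement that names `b mod Q`), on Step 9's actual obstruction (the unknown offset class `K`,
§0 — untouched), on sample complexity of repeated runs, on building measurements from the instance, or
on Cond. C.4–C.7; census row G7's verdict is unchanged.
-/

namespace Literature.Computability.Cryptography.Chen2024

open scoped BigOperators ComplexOrder
open Matrix

/-! ### 1. The Fourier bridge: conjugating a POVM by Chen's `QFT` -/

section Bridge

variable (k m : ℕ) [NeZero m]

/-- The matrix of Chen's unnormalised `QFT` on `ℤ_mᵏ` in the computational basis,
`F(u, z) = ψ_m(−⟨z, u⟩)`, so that `QFT ψ = F·ψ`. [cite: ChenQuantumLattice2024, Lemma 2.12 p. 12] -/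
noncomputable def qftMat : Matrix (Fin k → ZMod m) (Fin k → ZMod m) ℂ :=
  fun u z => ZMod.stdAddChar (-(∑ t, z t * u t))

variable {k m}

/-- Entries of `F`. [folklore] -/
private theorem qftMat_apply (u z : Fin k → ZMod m) :
    qftMat k m u z = ZMod.stdAddChar (-(∑ t, z t * u t)) := rfl

/-- `QFT ψ = F·ψ`. [cite: ChenQuantumLattice2024, Lemma 2.12 p. 12] -/
theorem qftMat_mulVec (ψ : Ket k m) : qftMat k m *ᵥ ψ = qft ψ := by
  funext u
  rw [qft_apply_eq_sum_stdAddChar]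
  change ∑ z, (ZMod.stdAddChar (-(∑ t, z t * u t)) : ℂ) * ψ z = _
  exact Finset.sum_congr rfl fun z _ => mul_comm _ _

/-- `conj ψ_m(x) = ψ_m(−x)`. [folklore] -/
private theorem star_stdAddChar (x : ZMod m) :
    star (ZMod.stdAddChar x : ℂ) = ZMod.stdAddChar (-x) := by
  rw [Complex.star_def, AddChar.map_neg_eq_conj]

omit [NeZero m] in
/-- `Σ_t (c − c′)_t w_t = Σ_t c_t w_t − Σ_t c′_t w_t`. [folklore] -/
private theorem linForm_sub (c c' w : Fin k → ZMod m) :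
    ∑ t, (c - c') t * w t = ∑ t, c t * w t - ∑ t, c' t * w t := by
  rw [← Finset.sum_sub_distrib]
  exact Finset.sum_congr rfl fun t _ => by rw [Pi.sub_apply, sub_mul]

omit [NeZero m] in
/-- `Σ_t w_t c_t − Σ_t w_t c′_t = Σ_t (c − c′)_t w_t`. [folklore] -/
private theorem linForm_sub' (c c' w : Fin k → ZMod m) :
    ∑ t, w t * c t - ∑ t, w t * c' t = ∑ t, (c - c') t * w t := by
  rw [← Finset.sum_sub_distrib]
  exact Finset.sum_congr rfl fun t _ => by rw [Pi.sub_apply]; ring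

/-- `Fᴴ F = mᵏ·1` (orthogonality of characters). [cite: ChenQuantumLattice2024, Lemma 2.12 p. 12] -/
theorem conjTranspose_qftMat_mul_self :
    (qftMat k m)ᴴ * qftMat k m
      = (((m : ℂ)) ^ k) • (1 : Matrix (Fin k → ZMod m) (Fin k → ZMod m) ℂ) := by
  ext z z'
  rw [Matrix.mul_apply, Matrix.smul_apply, Matrix.one_apply, smul_eq_mul, mul_ite, mul_one, mul_zero]
  have h : ∀ u, (qftMat k m)ᴴ z u * qftMat k m u z'
      = ZMod.stdAddChar (∑ t, (z - z') t * u t) := by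
    intro u
    rw [Matrix.conjTranspose_apply, qftMat_apply, qftMat_apply, star_stdAddChar, neg_neg,
      ← AddChar.map_add_eq_mul, ← sub_eq_add_neg, linForm_sub]
  rw [Finset.sum_congr rfl fun u _ => h u, sum_stdAddChar_linForm]
  by_cases hzz : z = z'
  · rw [if_pos (sub_eq_zero.2 hzz), if_pos hzz]
  · rw [if_neg (fun h' => hzz (sub_eq_zero.1 h')), if_neg hzz]

/-- `F Fᴴ = mᵏ·1`. [cite: ChenQuantumLattice2024, Lemma 2.12 p. 12] -/
theorem qftMat_mul_conjTranspose :
    qftMat k m * (qftMat k m)ᴴ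
      = (((m : ℂ)) ^ k) • (1 : Matrix (Fin k → ZMod m) (Fin k → ZMod m) ℂ) := by
  ext u u'
  rw [Matrix.mul_apply, Matrix.smul_apply, Matrix.one_apply, smul_eq_mul, mul_ite, mul_one, mul_zero]
  have h : ∀ z, qftMat k m u z * (qftMat k m)ᴴ z u'
      = ZMod.stdAddChar (∑ t, (u' - u) t * z t) := by
    intro z
    rw [Matrix.conjTranspose_apply, qftMat_apply, qftMat_apply, star_stdAddChar, neg_neg,
      ← AddChar.map_add_eq_mul, neg_add_eq_sub, linForm_sub']
  rw [Finset.sum_congr rfl fun z _ => h z, sum_stdAddChar_linForm]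
  by_cases huu : u = u'
  · rw [if_pos (sub_eq_zero.2 huu.symm), if_pos huu]
  · rw [if_neg (fun h' => huu (sub_eq_zero.1 h').symm), if_neg huu]

namespace POVM

variable {κ : Type*} [Fintype κ]

/-- **The Fourier conjugate of a POVM** on `ℤ_mᵏ`: `Ê_a = m^{−k}·F E_a Fᴴ`.  Since `m^{−k/2}F` is
unitary, `Ê` is again a POVM, and measuring `Ê` on `QFT ψ` is measuring `E` on `ψ`
(`fourierConj_weight`). [cite: ChenQuantumLattice2024, Lemma 2.12 p. 12; NielsenChuang2010, §2.2.6 p. 90] -/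
noncomputable def fourierConj (E : POVM (Fin k → ZMod m) κ) : POVM (Fin k → ZMod m) κ where
  effect a := ((((m : ℝ) ^ k)⁻¹ : ℝ) : ℂ) • (qftMat k m * E.effect a * (qftMat k m)ᴴ)
  posSemidef a := ((E.posSemidef a).mul_mul_conjTranspose_same (qftMat k m)).smul
    (Complex.zero_le_real.2 (inv_nonneg.2 (pow_nonneg (Nat.cast_nonneg _) _)))
  sum_eq_one := by
    have hm : ((m : ℂ)) ^ k ≠ 0 := pow_ne_zero _ (Nat.cast_ne_zero.2 (NeZero.ne m))
    rw [← Finset.smul_sum, ← Finset.sum_mul, ← Finset.mul_sum, E.sum_eq_one, Matrix.mul_one,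
      qftMat_mul_conjTranspose, smul_smul]
    have hc : ((((m : ℝ) ^ k)⁻¹ : ℝ) : ℂ) * ((m : ℂ)) ^ k = 1 := by
      push_cast
      exact inv_mul_cancel₀ hm
    rw [hc, one_smul]

/-- `Ê` on `QFT ψ` has `mᵏ` times the weights of `E` on `ψ`; as `‖QFT ψ‖² = mᵏ‖ψ‖²` (Plancherel),
the outcome probabilities coincide. [cite: ChenQuantumLattice2024, Lemma 2.12 p. 12; NielsenChuang2010, §2.2.6 p. 90] -/
theorem fourierConj_weight (E : POVM (Fin k → ZMod m) κ) (ψ : Ket k m) (a : κ) :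
    E.fourierConj.weight (qft ψ) a = ((m : ℂ)) ^ k * E.weight ψ a := by
  have hm : ((m : ℂ)) ^ k ≠ 0 := pow_ne_zero _ (Nat.cast_ne_zero.2 (NeZero.ne m))
  unfold weight fourierConj
  dsimp only
  rw [← qftMat_mulVec, Matrix.smul_mulVec, dotProduct_smul, Matrix.mulVec_mulVec,
    Matrix.mul_assoc (qftMat k m * E.effect a) ((qftMat k m)ᴴ) (qftMat k m),
    conjTranspose_qftMat_mul_self, Matrix.mul_smul, Matrix.mul_one, Matrix.smul_mulVec,
    ← Matrix.mulVec_mulVec, dotProduct_smul, qftMat_mulVec, qftMat_mulVec, dotProduct_qft_qft,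
    smul_eq_mul, smul_eq_mul]
  push_cast
  field_simp

end POVM

end Bridge

/-! ### 2. The offset-averaged success of a measurement on a direction -/

section Direction

variable (n : ℕ) (D p₁ Q : ℕ+)

/-- **The offset-averaged datum success `P̄_E(b)`** of a POVM `E` (outcomes in `ℤ_Q`) on the direction
`b`: the probability that `E`, applied to the Step-8 line ket `|φ_{b,u}⟩`, outputs its datum
`u₀ mod Q`, averaged uniformly over all offsets `u ∈ ℤ_N^{n+1}` (equivalently over the offset classes
`K` of §0 and their representatives) — total weight on the correct datum over total norm.
[cite: ChenQuantumLattice2024, §3.5.9 pp. 35–37; NielsenChuang2010, §2.2.6 p. 90] -/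
noncomputable def dirSuccess (b : Fin (n + 1) → ℤ) (E : POVM (Fin (n + 1) → ZN D p₁ Q) (ZQ Q)) : ℝ :=
  (∑ u : Fin (n + 1) → ZN D p₁ Q,
      E.weight (phi8bKet n D p₁ Q b (liftV n D p₁ Q u)) (toDatum D p₁ Q (u 0))).re
    / (∑ u : Fin (n + 1) → ZN D p₁ Q,
        (star (phi8bKet n D p₁ Q b (liftV n D p₁ Q u))
          ⬝ᵥ phi8bKet n D p₁ Q b (liftV n D p₁ Q u))).re

/-- `‖φ_{b,v′}‖² = P` for odd `P = p₁Q` — every direction, every offset (Plancherel and the flat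
spectrum T3). [cite: ChenQuantumLattice2024, §3.5.9 p. 35, Lemma 2.12 p. 12] -/
theorem phi8bKet_normSq_of_odd (hP : Odd ((p₁ * Q : ℕ+) : ℕ)) (b v' : Fin (n + 1) → ℤ) :
    star (phi8bKet n D p₁ Q b v') ⬝ᵥ phi8bKet n D p₁ Q b v' = ((((p₁ * Q : ℕ+) : ℕ) : ℂ)) := by
  have hN : ((((D * D * (p₁ * Q) : ℕ+) : ℕ) : ℂ)) ^ (n + 1) ≠ 0 :=
    pow_ne_zero _ (Nat.cast_ne_zero.2 (PNat.ne_zero _))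
  have h := dotProduct_qft_qft (phi8bKet n D p₁ Q b v') (phi8bKet n D p₁ Q b v')
  have hL : star (qft (phi8bKet n D p₁ Q b v')) ⬝ᵥ qft (phi8bKet n D p₁ Q b v')
      = ((((D * D * (p₁ * Q) : ℕ+) : ℕ) : ℂ)) ^ (n + 1) * ((((p₁ * Q : ℕ+) : ℕ) : ℂ)) := by
    have hu : ∀ u, star (qft (phi8bKet n D p₁ Q b v') u) * qft (phi8bKet n D p₁ Q b v') u
        = ((((p₁ * Q : ℕ+) : ℕ) : ℂ)) := by
      intro u
      rw [Complex.star_def, mul_comm]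
      exact fourierGram_self n D p₁ Q hP b v' u
    simp only [dotProduct, Pi.star_apply, hu, Finset.sum_const, Finset.card_univ, Fintype.card_fun,
      ZMod.card, Fintype.card_fin, nsmul_eq_mul, Nat.cast_pow]
  rw [hL] at h
  exact (mul_left_cancel₀ hN h).symm

/-- The denominator of `dirSuccess`: `N^{n+1}·P`. [cite: ChenQuantumLattice2024, §3.5.9 p. 35] -/
theorem dir_totalWeight (hP : Odd ((p₁ * Q : ℕ+) : ℕ)) (b : Fin (n + 1) → ℤ) :
    (∑ u : Fin (n + 1) → ZN D p₁ Q,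
        (star (phi8bKet n D p₁ Q b (liftV n D p₁ Q u))
          ⬝ᵥ phi8bKet n D p₁ Q b (liftV n D p₁ Q u))).re
      = ((((D * D * (p₁ * Q) : ℕ+) : ℕ) : ℝ)) ^ (n + 1) * ((((p₁ * Q : ℕ+) : ℕ) : ℝ)) := by
  simp only [phi8bKet_normSq_of_odd n D p₁ Q hP, Finset.sum_const, Finset.card_univ, Fintype.card_fun,
    ZMod.card, Fintype.card_fin, nsmul_eq_mul]
  rw [← Complex.ofReal_natCast, ← Complex.ofReal_natCast, ← Complex.ofReal_mul, Complex.ofReal_re]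
  push_cast
  ring

/-- The denominator of `dirSuccess` is positive. [folklore] -/
private theorem dir_totalWeight_pos (hP : Odd ((p₁ * Q : ℕ+) : ℕ)) (b : Fin (n + 1) → ℤ) :
    0 < (∑ u : Fin (n + 1) → ZN D p₁ Q,
        (star (phi8bKet n D p₁ Q b (liftV n D p₁ Q u))
          ⬝ᵥ phi8bKet n D p₁ Q b (liftV n D p₁ Q u))).re := by
  rw [dir_totalWeight n D p₁ Q hP]
  exact mul_pos (pow_pos (by exact_mod_cast PNat.pos _) _) (by exact_mod_cast PNat.pos _)

/-- `0 ≤ P̄_E(b)`. [cite: NielsenChuang2010, §2.2.6 p. 90] -/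
theorem dirSuccess_nonneg (hP : Odd ((p₁ * Q : ℕ+) : ℕ)) (b : Fin (n + 1) → ℤ)
    (E : POVM (Fin (n + 1) → ZN D p₁ Q) (ZQ Q)) : 0 ≤ dirSuccess n D p₁ Q b E := by
  unfold dirSuccess
  refine div_nonneg ?_ (dir_totalWeight_pos n D p₁ Q hP b).le
  rw [Complex.re_sum]
  exact Finset.sum_nonneg fun u _ => by
    have h := (Complex.le_def.1 (E.weight_nonneg (phi8bKet n D p₁ Q b (liftV n D p₁ Q u))
      (toDatum D p₁ Q (u 0)))).1
    simpa using h

/-- `P̄_E(b) ≤ 1`. [cite: NielsenChuang2010, §2.2.6 p. 90] -/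
theorem dirSuccess_le_one (hP : Odd ((p₁ * Q : ℕ+) : ℕ)) (b : Fin (n + 1) → ℤ)
    (E : POVM (Fin (n + 1) → ZN D p₁ Q) (ZQ Q)) : dirSuccess n D p₁ Q b E ≤ 1 := by
  unfold dirSuccess
  rw [div_le_one (dir_totalWeight_pos n D p₁ Q hP b), Complex.re_sum, Complex.re_sum]
  refine Finset.sum_le_sum fun u _ => ?_
  have h : E.weight (phi8bKet n D p₁ Q b (liftV n D p₁ Q u)) (toDatum D p₁ Q (u 0))
      ≤ star (phi8bKet n D p₁ Q b (liftV n D p₁ Q u)) ⬝ᵥ phi8bKet n D p₁ Q b (liftV n D p₁ Q u) := by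
    rw [← E.sum_weight]
    exact Finset.single_le_sum (fun a _ => E.weight_nonneg _ a) (Finset.mem_univ _)
  exact (Complex.le_def.1 h).1

end Direction

/-! ### 3. Mod-`Q` invariance of the offset-summed weights -/

section ModQ

variable (n : ℕ) (D p₁ Q : ℕ+)

/-- `⟨QFT φ_{β,v′}| E_a |QFT φ_{β,v′}⟩ = Σ_{x,y} (E_a)_{xy}·ρ̂(y,x)` in terms of the Fourier Gram entries
`ρ̂ = fourierGram`. [cite: NielsenChuang2010, §2.2.6 p. 90] -/
theorem weight_qft_phi8bKet_eq (E : POVM (Fin (n + 1) → ZN D p₁ Q) (ZQ Q))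
    (β v' : Fin (n + 1) → ℤ) (a : ZQ Q) :
    E.weight (qft (phi8bKet n D p₁ Q β v')) a
      = ∑ x, ∑ y, E.effect a x y * fourierGram n D p₁ Q β v' y x := by
  unfold POVM.weight fourierGram
  simp only [dotProduct, Matrix.mulVec, Pi.star_apply, Complex.star_def, Finset.mul_sum]
  exact Finset.sum_congr rfl fun x _ => Finset.sum_congr rfl fun y _ => by ring

/-- With the canonical lift of `u ∈ ℤ_N^{n+1}` as offset, the offset phase exponent is the dot product:
`⟨liftV u, ζ⟩ = u·ζ`. [folklore] -/
private theorem offsetFun_liftV (u ζ : Fin (n + 1) → ZN D p₁ Q) :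
    offsetFun n D p₁ Q (liftV n D p₁ Q u) ζ = u ⬝ᵥ ζ := by
  unfold offsetFun
  simp only [intCast_liftV, dotProduct]

/-- Translating the offsets by `t` with `t₀ ≡ 0 (mod Q)` preserves the datum fibres and multiplies the
datum character sum `T_a(ζ) = Σ_{u : u₀ ≡ a} ψ_N(u·ζ)` by `ψ_N(t·ζ)`. [folklore] -/
private theorem datumCharSum_translate (a : ZQ Q) (ζ t : Fin (n + 1) → ZN D p₁ Q)
    (ht : toDatum D p₁ Q (t 0) = 0) :
    ∑ u ∈ Finset.univ.filter (fun u : Fin (n + 1) → ZN D p₁ Q => toDatum D p₁ Q (u 0) = a),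
        (ZMod.stdAddChar (u ⬝ᵥ ζ) : ℂ)
      = ZMod.stdAddChar (t ⬝ᵥ ζ)
        * ∑ u ∈ Finset.univ.filter (fun u : Fin (n + 1) → ZN D p₁ Q => toDatum D p₁ Q (u 0) = a),
            (ZMod.stdAddChar (u ⬝ᵥ ζ) : ℂ) := by
  rw [Finset.sum_filter, Finset.mul_sum,
    ← Equiv.sum_comp (Equiv.addRight t) (fun u : Fin (n + 1) → ZN D p₁ Q =>
      if toDatum D p₁ Q (u 0) = a then (ZMod.stdAddChar (u ⬝ᵥ ζ) : ℂ) else 0)]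
  refine Finset.sum_congr rfl fun u _ => ?_
  simp only [Equiv.coe_addRight, Pi.add_apply, map_add, ht, add_zero, add_dotProduct,
    AddChar.map_add_eq_mul]
  split_ifs <;> ring

/-- From `T = c·T` with `T ≠ 0`: `c = 1`. [folklore] -/
private theorem eq_one_of_mul_eq_self {T c : ℂ} (hT : T ≠ 0) (h : T = c * T) : c = 1 :=
  (mul_eq_right₀ hT).1 h.symm

/-- **Support of the datum character sums.**  `T_a(ζ) = Σ_{u : u₀ ≡ a (mod Q)} ψ_N(u·ζ)` vanishes unless
`ζ_i = 0` for `i ≠ 0` and `Q·ζ₀ = 0`. [folklore] -/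
private theorem datumCharSum_eq_zero_or (a : ZQ Q) (ζ : Fin (n + 1) → ZN D p₁ Q) :
    (∑ u ∈ Finset.univ.filter (fun u : Fin (n + 1) → ZN D p₁ Q => toDatum D p₁ Q (u 0) = a),
        (ZMod.stdAddChar (u ⬝ᵥ ζ) : ℂ)) = 0
      ∨ ((∀ i, i ≠ 0 → ζ i = 0) ∧ (((Q : ℕ+) : ℕ) : ZN D p₁ Q) * ζ 0 = 0) := by
  classical
  by_cases h0 : (∑ u ∈ Finset.univ.filter
      (fun u : Fin (n + 1) → ZN D p₁ Q => toDatum D p₁ Q (u 0) = a),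
        (ZMod.stdAddChar (u ⬝ᵥ ζ) : ℂ)) = 0
  · exact Or.inl h0
  refine Or.inr ⟨fun i hi => ?_, ?_⟩
  · have h := datumCharSum_translate n D p₁ Q a ζ (Pi.single i 1)
      (by rw [Pi.single_eq_of_ne (Ne.symm hi), map_zero])
    rw [single_dotProduct, one_mul] at h
    have h1 := eq_one_of_mul_eq_self h0 h
    rw [← (ZMod.stdAddChar (N := ((D * D * (p₁ * Q) : ℕ+) : ℕ))).map_zero_eq_one] at h1
    exact ZMod.injective_stdAddChar h1
  · have h := datumCharSum_translate n D p₁ Q a ζ (Pi.single 0 ((((Q : ℕ+) : ℕ) : ZN D p₁ Q)))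
      (by rw [Pi.single_eq_same, map_natCast, ZMod.natCast_self])
    rw [single_dotProduct] at h
    have h1 := eq_one_of_mul_eq_self h0 h
    rw [← (ZMod.stdAddChar (N := ((D * D * (p₁ * Q) : ℕ+) : ℕ))).map_zero_eq_one] at h1
    exact ZMod.injective_stdAddChar h1

/-- The datum-weighted character sum over offsets with an effect table in front vanishes off the
admissible differences `ζ = x − y` (`ζ_i = 0` for `i ≠ 0`, `Qζ₀ = 0`). [folklore] -/
private theorem effect_datumCharSum_eq_zero (E : POVM (Fin (n + 1) → ZN D p₁ Q) (ZQ Q))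
    (x y : Fin (n + 1) → ZN D p₁ Q)
    (hζ : ¬ ((∀ i, i ≠ 0 → (x - y) i = 0) ∧ (((Q : ℕ+) : ℕ) : ZN D p₁ Q) * (x - y) 0 = 0)) :
    ∑ u : Fin (n + 1) → ZN D p₁ Q,
        E.effect (toDatum D p₁ Q (u 0)) x y * (ZMod.stdAddChar (u ⬝ᵥ (x - y)) : ℂ) = 0 := by
  classical
  rw [← Finset.sum_fiberwise Finset.univ (fun u : Fin (n + 1) → ZN D p₁ Q => toDatum D p₁ Q (u 0))
    (fun u => E.effect (toDatum D p₁ Q (u 0)) x y * (ZMod.stdAddChar (u ⬝ᵥ (x - y)) : ℂ))]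
  refine Finset.sum_eq_zero fun a _ => ?_
  have hT := (datumCharSum_eq_zero_or n D p₁ Q a (x - y)).resolve_right hζ
  calc ∑ u ∈ Finset.univ.filter (fun u : Fin (n + 1) → ZN D p₁ Q => toDatum D p₁ Q (u 0) = a),
          E.effect (toDatum D p₁ Q (u 0)) x y * (ZMod.stdAddChar (u ⬝ᵥ (x - y)) : ℂ)
      = ∑ u ∈ Finset.univ.filter (fun u : Fin (n + 1) → ZN D p₁ Q => toDatum D p₁ Q (u 0) = a),
          E.effect a x y * (ZMod.stdAddChar (u ⬝ᵥ (x - y)) : ℂ) := by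
        refine Finset.sum_congr rfl fun u hu => ?_
        rw [(Finset.mem_filter.1 hu).2]
    _ = 0 := by rw [← Finset.mul_sum, hT, mul_zero]

/-- `lineFun` is additive in the direction. [folklore] -/
private theorem lineFun_add_dir (β γ : Fin (n + 1) → ℤ) (x : Fin (n + 1) → ZN D p₁ Q) :
    lineFun n D p₁ Q (β + γ) x = lineFun n D p₁ Q β x + lineFun n D p₁ Q γ x := by
  unfold lineFun
  rw [← Finset.sum_add_distrib]
  exact Finset.sum_congr rfl fun i _ => by rw [Pi.add_apply, Int.cast_add, add_mul]

/-- On a vector supported on coordinate `0`: `lineFun β ζ = β₀·(ζ₀ mod P)`. [folklore] -/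
private theorem lineFun_of_tail_zero (β : Fin (n + 1) → ℤ) {ζ : Fin (n + 1) → ZN D p₁ Q}
    (hζ : ∀ i, i ≠ 0 → ζ i = 0) :
    lineFun n D p₁ Q β ζ = ((β 0 : ℤ) : ZP p₁ Q) * toP D (p₁ * Q) (ζ 0) := by
  unfold lineFun
  rw [Finset.sum_eq_single (0 : Fin (n + 1)) (fun i _ hi => by rw [hζ i hi, map_zero, mul_zero])
    (fun h => absurd (Finset.mem_univ _) h)]

/-- On an admissible difference, `Q·lineFun β ζ = 0`. [folklore] -/
private theorem Q_mul_lineFun_eq_zero (β : Fin (n + 1) → ℤ) {ζ : Fin (n + 1) → ZN D p₁ Q}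
    (hζ : ∀ i, i ≠ 0 → ζ i = 0) (hζ0 : (((Q : ℕ+) : ℕ) : ZN D p₁ Q) * ζ 0 = 0) :
    (((Q : ℕ+) : ℕ) : ZP p₁ Q) * lineFun n D p₁ Q β ζ = 0 := by
  have hQt : (((Q : ℕ+) : ℕ) : ZP p₁ Q) * toP D (p₁ * Q) (ζ 0) = 0 := by
    rw [← map_natCast (toP D (p₁ * Q)), ← map_mul, hζ0, map_zero]
  rw [lineFun_of_tail_zero n D p₁ Q β hζ]
  linear_combination (((β 0 : ℤ) : ZP p₁ Q)) * hQt

/-- A direction `≡ 0 (mod Q)` coordinatewise kills admissible differences: `lineFun γ ζ = 0`.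
[folklore] -/
private theorem lineFun_eq_zero_of_modQ (γ : Fin (n + 1) → ℤ) (hγ : ∀ i, ((γ i : ℤ) : ZQ Q) = 0)
    {ζ : Fin (n + 1) → ZN D p₁ Q} (hζ : ∀ i, i ≠ 0 → ζ i = 0)
    (hζ0 : (((Q : ℕ+) : ℕ) : ZN D p₁ Q) * ζ 0 = 0) :
    lineFun n D p₁ Q γ ζ = 0 := by
  have hQt : (((Q : ℕ+) : ℕ) : ZP p₁ Q) * toP D (p₁ * Q) (ζ 0) = 0 := by
    rw [← map_natCast (toP D (p₁ * Q)), ← map_mul, hζ0, map_zero]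
  rw [lineFun_of_tail_zero n D p₁ Q γ hζ]
  obtain ⟨r, hr⟩ := exists_eq_Q_mul_of_toQ_eq_zero p₁ Q (x := ((γ 0 : ℤ) : ZP p₁ Q))
    (by rw [map_intCast]; exact hγ 0)
  rw [hr]
  linear_combination r * hQt

/-- Directions congruent mod `Q` have hyperplane functionals differing by a multiple of `Q`.
[folklore] -/
private theorem exists_lineFun_eq_add_Q_mul {b bt : Fin (n + 1) → ℤ}
    (hmod : ∀ i, ((b i : ℤ) : ZQ Q) = ((bt i : ℤ) : ZQ Q)) (x : Fin (n + 1) → ZN D p₁ Q) :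
    ∃ ρ : ZP p₁ Q,
      lineFun n D p₁ Q bt x = lineFun n D p₁ Q b x + (((Q : ℕ+) : ℕ) : ZP p₁ Q) * ρ := by
  have hsplit : lineFun n D p₁ Q bt x = lineFun n D p₁ Q b x + lineFun n D p₁ Q (bt - b) x := by
    rw [← lineFun_add_dir, add_sub_cancel]
  have h0 : toQ p₁ Q (lineFun n D p₁ Q (bt - b) x) = 0 := by
    unfold lineFun
    rw [map_sum]
    refine Finset.sum_eq_zero fun i _ => ?_
    rw [map_mul, map_intCast, Pi.sub_apply, Int.cast_sub, ← hmod i, sub_self, zero_mul]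
  obtain ⟨ρ, hρ⟩ := exists_eq_Q_mul_of_toQ_eq_zero p₁ Q h0
  exact ⟨ρ, by rw [hsplit, hρ]⟩

/-- **The chirp phases of congruent directions agree on admissible differences**:
`L_b(y)² − L_b(x)² = L_b̃(y)² − L_b̃(x)²` in `ℤ_P` whenever `b ≡ b̃ (mod Q)` and `x − y` is admissible.
[cite: ChenQuantumLattice2024, §3.5.9 p. 35] -/
theorem chirpPhase_congr_mod {b bt : Fin (n + 1) → ℤ}
    (hmod : ∀ i, ((b i : ℤ) : ZQ Q) = ((bt i : ℤ) : ZQ Q)) {x y : Fin (n + 1) → ZN D p₁ Q}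
    (hζ : ∀ i, i ≠ 0 → (x - y) i = 0) (hζ0 : (((Q : ℕ+) : ℕ) : ZN D p₁ Q) * (x - y) 0 = 0) :
    lineFun n D p₁ Q b y ^ 2 - lineFun n D p₁ Q b x ^ 2
      = lineFun n D p₁ Q bt y ^ 2 - lineFun n D p₁ Q bt x ^ 2 := by
  obtain ⟨ρ, hρ⟩ := exists_lineFun_eq_add_Q_mul n D p₁ Q hmod y
  have h1 : (((Q : ℕ+) : ℕ) : ZP p₁ Q) * (lineFun n D p₁ Q b x - lineFun n D p₁ Q b y) = 0 := by
    rw [lineFun_sub]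
    exact Q_mul_lineFun_eq_zero n D p₁ Q b hζ hζ0
  have hd : lineFun n D p₁ Q bt x - lineFun n D p₁ Q bt y
      = lineFun n D p₁ Q b x - lineFun n D p₁ Q b y := by
    rw [lineFun_sub, lineFun_sub]
    have hsplit : lineFun n D p₁ Q bt (x - y)
        = lineFun n D p₁ Q b (x - y) + lineFun n D p₁ Q (bt - b) (x - y) := by
      rw [← lineFun_add_dir, add_sub_cancel]
    rw [hsplit, lineFun_eq_zero_of_modQ n D p₁ Q (bt - b)
      (fun i => by rw [Pi.sub_apply, Int.cast_sub, hmod i, sub_self]) hζ hζ0, add_zero]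
  have hx : lineFun n D p₁ Q bt x = lineFun n D p₁ Q b x + (((Q : ℕ+) : ℕ) : ZP p₁ Q) * ρ := by
    linear_combination hd + hρ
  rw [hρ, hx]
  linear_combination (2 * ρ) * h1

/-- **MOD-`Q` INVARIANCE (Fourier side).**  For ANY POVM `E` with outcomes in `ℤ_Q`, the total weight
on the correct datum, summed over all offsets, `Σ_u ⟨QFT φ_{β,u}| E_{u₀ mod Q} |QFT φ_{β,u}⟩`, depends
on the direction `β` only through `β mod Q` — although the individual kets and even the datum
projectors mod `N` do not. [cite: ChenQuantumLattice2024, §3.5.9 pp. 35–37; NielsenChuang2010, §2.2.6 p. 90] -/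
theorem sum_weight_qft_congr_mod {b bt : Fin (n + 1) → ℤ}
    (hmod : ∀ i, ((b i : ℤ) : ZQ Q) = ((bt i : ℤ) : ZQ Q))
    (E : POVM (Fin (n + 1) → ZN D p₁ Q) (ZQ Q)) :
    ∑ u : Fin (n + 1) → ZN D p₁ Q,
        E.weight (qft (phi8bKet n D p₁ Q b (liftV n D p₁ Q u))) (toDatum D p₁ Q (u 0))
      = ∑ u : Fin (n + 1) → ZN D p₁ Q,
        E.weight (qft (phi8bKet n D p₁ Q bt (liftV n D p₁ Q u))) (toDatum D p₁ Q (u 0)) := by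
  classical
  -- the common rearrangement: sum over offsets innermost
  have key : ∀ β : Fin (n + 1) → ℤ,
      ∑ u : Fin (n + 1) → ZN D p₁ Q,
          E.weight (qft (phi8bKet n D p₁ Q β (liftV n D p₁ Q u))) (toDatum D p₁ Q (u 0))
        = ∑ x : Fin (n + 1) → ZN D p₁ Q, ∑ y : Fin (n + 1) → ZN D p₁ Q,
            (∑ u : Fin (n + 1) → ZN D p₁ Q,
                E.effect (toDatum D p₁ Q (u 0)) x y * (ZMod.stdAddChar (u ⬝ᵥ (x - y)) : ℂ))
              * (ZMod.stdAddChar (lineFun n D p₁ Q β y ^ 2 - lineFun n D p₁ Q β x ^ 2)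
                  * (lineGauss p₁ Q 0 * (starRingEnd ℂ) (lineGauss p₁ Q 0))) := by
    intro β
    calc ∑ u : Fin (n + 1) → ZN D p₁ Q,
            E.weight (qft (phi8bKet n D p₁ Q β (liftV n D p₁ Q u))) (toDatum D p₁ Q (u 0))
        = ∑ u : Fin (n + 1) → ZN D p₁ Q, ∑ x : Fin (n + 1) → ZN D p₁ Q,
            ∑ y : Fin (n + 1) → ZN D p₁ Q,
              E.effect (toDatum D p₁ Q (u 0)) x y * (ZMod.stdAddChar (u ⬝ᵥ (x - y)) : ℂ)
                * (ZMod.stdAddChar (lineFun n D p₁ Q β y ^ 2 - lineFun n D p₁ Q β x ^ 2)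
                    * (lineGauss p₁ Q 0 * (starRingEnd ℂ) (lineGauss p₁ Q 0))) := by
          refine Finset.sum_congr rfl fun u _ => ?_
          rw [weight_qft_phi8bKet_eq]
          refine Finset.sum_congr rfl fun x _ => Finset.sum_congr rfl fun y _ => ?_
          rw [fourierGram_eq, offsetFun_liftV]
          ring
      _ = ∑ x : Fin (n + 1) → ZN D p₁ Q, ∑ y : Fin (n + 1) → ZN D p₁ Q,
            ∑ u : Fin (n + 1) → ZN D p₁ Q,
              E.effect (toDatum D p₁ Q (u 0)) x y * (ZMod.stdAddChar (u ⬝ᵥ (x - y)) : ℂ)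
                * (ZMod.stdAddChar (lineFun n D p₁ Q β y ^ 2 - lineFun n D p₁ Q β x ^ 2)
                    * (lineGauss p₁ Q 0 * (starRingEnd ℂ) (lineGauss p₁ Q 0))) := by
          rw [Finset.sum_comm]
          exact Finset.sum_congr rfl fun x _ => Finset.sum_comm
      _ = _ := by
          refine Finset.sum_congr rfl fun x _ => Finset.sum_congr rfl fun y _ => ?_
          rw [Finset.sum_mul]
  rw [key b, key bt]
  refine Finset.sum_congr rfl fun x _ => Finset.sum_congr rfl fun y _ => ?_
  by_cases hC : (∀ i, i ≠ 0 → (x - y) i = 0) ∧ (((Q : ℕ+) : ℕ) : ZN D p₁ Q) * (x - y) 0 = 0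
  · rw [chirpPhase_congr_mod n D p₁ Q hmod hC.1 hC.2]
  · rw [effect_datumCharSum_eq_zero n D p₁ Q E x y hC, zero_mul, zero_mul]

/-- **MOD-`Q` INVARIANCE (position side).**  `Σ_u ⟨φ_{b,u}| E_{u₀ mod Q} |φ_{b,u}⟩` depends on `b`
only mod `Q`, for every POVM `E` (via the Fourier conjugate `Ê`). [cite: ChenQuantumLattice2024, §3.5.9 pp. 35–37, Lemma 2.12 p. 12] -/
theorem sum_weight_congr_mod {b bt : Fin (n + 1) → ℤ}
    (hmod : ∀ i, ((b i : ℤ) : ZQ Q) = ((bt i : ℤ) : ZQ Q))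
    (E : POVM (Fin (n + 1) → ZN D p₁ Q) (ZQ Q)) :
    ∑ u : Fin (n + 1) → ZN D p₁ Q,
        E.weight (phi8bKet n D p₁ Q b (liftV n D p₁ Q u)) (toDatum D p₁ Q (u 0))
      = ∑ u : Fin (n + 1) → ZN D p₁ Q,
        E.weight (phi8bKet n D p₁ Q bt (liftV n D p₁ Q u)) (toDatum D p₁ Q (u 0)) := by
  have h := sum_weight_qft_congr_mod n D p₁ Q hmod E.fourierConj
  simp only [POVM.fourierConj_weight, ← Finset.mul_sum] at h
  exact mul_left_cancel₀ (pow_ne_zero _ (Nat.cast_ne_zero.2 (PNat.ne_zero _))) h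

/-- **`P̄_E(b)` depends on `b` only mod `Q`** (any POVM, any directions, odd `P`).
[cite: ChenQuantumLattice2024, §3.5.9 pp. 35–37; NielsenChuang2010, §2.2.6 p. 90] -/
theorem dirSuccess_congr_mod (hP : Odd ((p₁ * Q : ℕ+) : ℕ)) {b bt : Fin (n + 1) → ℤ}
    (hmod : ∀ i, ((b i : ℤ) : ZQ Q) = ((bt i : ℤ) : ZQ Q))
    (E : POVM (Fin (n + 1) → ZN D p₁ Q) (ZQ Q)) :
    dirSuccess n D p₁ Q b E = dirSuccess n D p₁ Q bt E := by
  unfold dirSuccess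
  rw [sum_weight_congr_mod n D p₁ Q hmod E, dir_totalWeight n D p₁ Q hP b,
    dir_totalWeight n D p₁ Q hP bt]

end ModQ

/-! ### 4. The two-class law T19 averaged over the offsets -/

section Averaging

variable (n : ℕ) (D p₁ Q : ℕ+)

/-- **T19 averaged over all offsets (Fourier side).**  For `P` odd, a direction `b̃` with head `−1`
and `p₁ ∣ b̃_i (i ≥ 1)`, `D²p₁` a unit mod `Q`, ANY POVM `E` with outcomes in `ℤ_Q` and two secrets
`s₀, s₁ ∈ ℤ_Q^{n+1}` (directions `b̃ + 2p₁s₀𝟙_U`, `b̃ + 2p₁s₁𝟙_U`, `U = {1,…,n}`): the offset-summed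
weights on the correct datum obey `F(s₀) + F(s₁) ≤ (1 + 1/#span(s₁ − s₀))·P·N^{2(n+1)}`.  (T19 for the
relabelled POVM `d ↦ (D²p₁)^{−1}(v₀ − d)`, summed over `v`; each sub-class sum is `Q·Q^{n+1}` offset
sums.) [cite: ChenQuantumLattice2024, §3.5.9 pp. 35–37; NielsenChuang2010, §2.2.6 p. 90] -/
theorem fourier_secret_pair_le (hP : Odd ((p₁ * Q : ℕ+) : ℕ)) {bt : Fin (n + 1) → ℤ}
    (hbt0 : bt 0 = -1) (hbtp : ∀ i, i ≠ 0 → ((p₁ : ℕ) : ℤ) ∣ bt i)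
    (hκ : IsUnit (((D * D * p₁ : ℕ)) : ZQ Q))
    (E : POVM (Fin (n + 1) → ZN D p₁ Q) (ZQ Q)) (s₀ s₁ : Fin (n + 1) → ZQ Q) :
    (∑ u : Fin (n + 1) → ZN D p₁ Q,
        E.weight (qft (phi8bKet n D p₁ Q (bt + secretShift n p₁ Q (Finset.univ.erase 0) s₀)
          (liftV n D p₁ Q u))) (toDatum D p₁ Q (u 0))).re
      + (∑ u : Fin (n + 1) → ZN D p₁ Q,
        E.weight (qft (phi8bKet n D p₁ Q (bt + secretShift n p₁ Q (Finset.univ.erase 0) s₁)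
          (liftV n D p₁ Q u))) (toDatum D p₁ Q (u 0))).re
      ≤ (1 + ((Nat.card (span Q (secretDiff n Q (Finset.univ.erase 0) s₀ s₁)) : ℝ))⁻¹)
        * ((((p₁ * Q : ℕ+) : ℕ) : ℝ) * ((((D * D * (p₁ * Q) : ℕ+) : ℕ) : ℝ)) ^ (n + 1)
            * ((((D * D * (p₁ * Q) : ℕ+) : ℕ) : ℝ)) ^ (n + 1)) := by
  classical
  set U₀ : Finset (Fin (n + 1)) := Finset.univ.erase 0 with hU₀
  have h0U : (0 : Fin (n + 1)) ∉ U₀ := Finset.notMem_erase 0 _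
  -- T19's hypotheses for `(U₀, bk = b = b̃)`
  have hb : ∀ i ∈ U₀, ((p₁ : ℕ) : ℤ) ∣ bt i := fun i hi => hbtp i (Finset.mem_erase.1 hi).1
  have hbk : ∀ i, i ∉ U₀ → bt i = bt i := fun _ _ => rfl
  have hunit : ∃ i₀, i₀ ∉ U₀ ∧ IsUnit ((bt i₀ : ℤ) : ZQ Q) :=
    ⟨0, h0U, by rw [hbt0]; push_cast; exact isUnit_one.neg⟩
  -- the unit `κ = D²p₁ mod Q` and the relabelling `d ↦ κ⁻¹(v₀ − d)`
  set κ : ZQ Q := ((D * D * p₁ : ℕ) : ZQ Q) with hκdef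
  have hκκ : κ * κ⁻¹ = 1 := ZMod.mul_inv_of_unit κ hκ
  have hκκ' : κ⁻¹ * κ = 1 := by rw [mul_comm]; exact hκκ
  set g : (Fin (n + 1) → ZN D p₁ Q) → ZQ Q → ZQ Q :=
    fun v d => κ⁻¹ * (toDatum D p₁ Q (v 0) - d) with hg
  have hfib : ∀ (v : Fin (n + 1) → ZN D p₁ Q) (a : ZQ Q),
      Finset.univ.filter (fun d => g v d = a) = {toDatum D p₁ Q (v 0) - κ * a} := by
    intro v a
    ext d
    simp only [Finset.mem_filter, Finset.mem_univ, true_and, Finset.mem_singleton, hg]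
    constructor
    · intro h
      have h' : κ * (κ⁻¹ * (toDatum D p₁ Q (v 0) - d)) = κ * a := by rw [h]
      rw [← mul_assoc, hκκ, one_mul] at h'
      rw [← h', sub_sub_cancel]
    · intro h
      rw [h, sub_sub_cancel, ← mul_assoc, hκκ', one_mul]
  have hFw : ∀ (v : Fin (n + 1) → ZN D p₁ Q) (ψ : (Fin (n + 1) → ZN D p₁ Q) → ℂ) (a : ZQ Q),
      (E.map (g v)).weight ψ a = E.weight ψ (toDatum D p₁ Q (v 0) - κ * a) := by
    intro v ψ a
    rw [POVM.map_weight, hfib, Finset.sum_singleton]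
  -- the offset sum as a function of the offset, and the class translations
  set G : (Fin (n + 1) → ZQ Q) → (Fin (n + 1) → ZN D p₁ Q) → ℂ := fun s u =>
    E.weight (qft (phi8bKet n D p₁ Q (bt + secretShift n p₁ Q U₀ s) (liftV n D p₁ Q u)))
      (toDatum D p₁ Q (u 0)) with hG
  set τ : ZQ Q → (Fin (n + 1) → ZQ Q) → (Fin (n + 1) → ZN D p₁ Q) :=
    fun a c i => ((classShift n D p₁ Q U₀ bt a c i : ℤ) : ZN D p₁ Q) with hτ
  -- every member of T19's sub-class is a plain line ket at a translated offset …
  have hket : ∀ (v : Fin (n + 1) → ZN D p₁ Q) (a : ZQ Q) (s c : Fin (n + 1) → ZQ Q),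
      datumKet n D p₁ Q U₀ bt bt (liftV n D p₁ Q v) a (s, c)
        = qft (phi8bKet n D p₁ Q (bt + secretShift n p₁ Q U₀ s)
            (liftV n D p₁ Q (v + τ a c))) := by
    intro v a s c
    unfold datumKet
    exact congrArg qft (phi8bKet_congr_mod n D p₁ Q _ fun i => by
      simp only [Pi.add_apply, Int.cast_add, intCast_liftV, hτ])
  -- … whose datum is `v₀ − κ·a (mod Q)`
  have hdat : ∀ (v : Fin (n + 1) → ZN D p₁ Q) (a : ZQ Q) (c : Fin (n + 1) → ZQ Q),
      toDatum D p₁ Q ((v + τ a c) 0) = toDatum D p₁ Q (v 0) - κ * a := by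
    intro v a c
    have htail : classTail n Q U₀ c 0 = 0 := by simp only [classTail, if_neg h0U]
    simp only [Pi.add_apply, map_add, hτ, toDatum_intCast, classShift, htail, hbt0, hκdef,
      Nat.cast_zero, add_zero]
    push_cast
    rw [ZMod.natCast_zmod_val]
    ring
  -- hence T19's numerator for the relabelled POVM is a sum of translates of `G`
  have hNum : ∀ (v : Fin (n + 1) → ZN D p₁ Q) (s : Fin (n + 1) → ZQ Q),
      ∑ a : ZQ Q, ∑ c : Fin (n + 1) → ZQ Q,
          (E.map (g v)).weight (datumKet n D p₁ Q U₀ bt bt (liftV n D p₁ Q v) a (s, c)) a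
        = ∑ a : ZQ Q, ∑ c : Fin (n + 1) → ZQ Q, G s (v + τ a c) := by
    intro v s
    refine Finset.sum_congr rfl fun a _ => Finset.sum_congr rfl fun c _ => ?_
    rw [hFw, hket, ← hdat v a c]
  -- summing over all offsets `v`: `Q·Q^{n+1}` copies of `Σ_u G u`
  have hSum : ∀ s : Fin (n + 1) → ZQ Q,
      ∑ v : Fin (n + 1) → ZN D p₁ Q, ∑ a : ZQ Q, ∑ c : Fin (n + 1) → ZQ Q, G s (v + τ a c)
        = ((Fintype.card (ZQ Q) * Fintype.card (Fin (n + 1) → ZQ Q) : ℕ) : ℂ)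
            * ∑ u : Fin (n + 1) → ZN D p₁ Q, G s u := by
    intro s
    rw [Finset.sum_comm]
    have ha : ∀ a : ZQ Q,
        ∑ v : Fin (n + 1) → ZN D p₁ Q, ∑ c : Fin (n + 1) → ZQ Q, G s (v + τ a c)
          = (Fintype.card (Fin (n + 1) → ZQ Q) : ℂ) * ∑ u : Fin (n + 1) → ZN D p₁ Q, G s u := by
      intro a
      rw [Finset.sum_comm]
      have hc : ∀ c : Fin (n + 1) → ZQ Q,
          ∑ v : Fin (n + 1) → ZN D p₁ Q, G s (v + τ a c) = ∑ u, G s u := fun c =>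
        Equiv.sum_comp (Equiv.addRight (τ a c)) (G s)
      simp only [hc, Finset.sum_const, Finset.card_univ, nsmul_eq_mul]
    simp only [ha, Finset.sum_const, Finset.card_univ, nsmul_eq_mul, Nat.cast_mul]
    ring
  -- T19 for each offset, denominators evaluated (`secret_totalWeight`)
  have hW := secret_totalWeight n D p₁ Q hP U₀ bt bt
  set W : ℝ := (((Q : ℕ+) : ℕ) : ℝ) * (((Q : ℕ+) : ℕ) : ℝ) ^ (n + 1)
        * ((((p₁ * Q : ℕ+) : ℕ) : ℝ) * (((D * D * (p₁ * Q) : ℕ+) : ℕ) : ℝ) ^ (n + 1)) with hWdef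
  have hWpos : 0 < W := by positivity
  set Sinv : ℝ := ((Nat.card (span Q (secretDiff n Q U₀ s₀ s₁)) : ℝ))⁻¹ with hSinv
  have hv : ∀ v : Fin (n + 1) → ZN D p₁ Q,
      (∑ a : ZQ Q, ∑ c : Fin (n + 1) → ZQ Q, G s₀ (v + τ a c)).re
        + (∑ a : ZQ Q, ∑ c : Fin (n + 1) → ZQ Q, G s₁ (v + τ a c)).re ≤ (1 + Sinv) * W := by
    intro v
    have h := secretSuccess_add_le n D p₁ Q hP U₀ bt bt (liftV n D p₁ Q v) hb hb hbk hunit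
      (E.map (g v)) s₀ s₁
    unfold secretSuccess at h
    rw [hW, hW, hNum, hNum, ← add_div, div_le_iff₀ hWpos] at h
    exact h
  -- sum over `v`
  have hsum := Finset.sum_le_sum fun v (_ : v ∈ (Finset.univ : Finset (Fin (n + 1) → ZN D p₁ Q))) =>
    hv v
  rw [Finset.sum_add_distrib, ← Complex.re_sum, ← Complex.re_sum, hSum, hSum, Finset.sum_const,
    Finset.card_univ, nsmul_eq_mul] at hsum
  -- numeric bookkeeping
  have hcardQ : ((Fintype.card (ZQ Q) * Fintype.card (Fin (n + 1) → ZQ Q) : ℕ) : ℂ)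
      = (((((Q : ℕ+) : ℕ) : ℝ) * (((Q : ℕ+) : ℕ) : ℝ) ^ (n + 1) : ℝ) : ℂ) := by
    rw [Fintype.card_fun, ZMod.card, Fintype.card_fin]
    push_cast
    ring
  have hcardN : ((Fintype.card (Fin (n + 1) → ZN D p₁ Q) : ℕ) : ℝ)
      = ((((D * D * (p₁ * Q) : ℕ+) : ℕ) : ℝ)) ^ (n + 1) := by
    rw [Fintype.card_fun, ZMod.card, Fintype.card_fin]
    push_cast
    ring
  rw [hcardQ, Complex.re_ofReal_mul, Complex.re_ofReal_mul, hcardN] at hsum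
  have hc : (0 : ℝ) < (((Q : ℕ+) : ℕ) : ℝ) * (((Q : ℕ+) : ℕ) : ℝ) ^ (n + 1) := by positivity
  change (∑ u, G s₀ u).re + (∑ u, G s₁ u).re ≤ (1 + Sinv) * _
  refine le_of_mul_le_mul_left ?_ hc
  calc (((Q : ℕ+) : ℕ) : ℝ) * (((Q : ℕ+) : ℕ) : ℝ) ^ (n + 1) * ((∑ u, G s₀ u).re + (∑ u, G s₁ u).re)
      = (((Q : ℕ+) : ℕ) : ℝ) * (((Q : ℕ+) : ℕ) : ℝ) ^ (n + 1) * (∑ u, G s₀ u).re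
          + (((Q : ℕ+) : ℕ) : ℝ) * (((Q : ℕ+) : ℕ) : ℝ) ^ (n + 1) * (∑ u, G s₁ u).re := by ring
    _ ≤ _ := hsum
    _ = _ := by rw [hWdef]; ring

end Averaging

/-! ### 5. The two-direction law, its attainment, and the tolerance floor -/

section Law

variable (n : ℕ) (D p₁ Q : ℕ+)

/-- The duality fraction of T19's secret difference (for `U = {1,…,n}`, `s₀ = 0`, `s₁ = w·(b′ − b)`, `w`
a unit) is that of the direction difference `b − b′ mod Q` when the heads agree. [folklore] -/
private theorem inv_card_span_secretDiff_eq {b b' : Fin (n + 1) → ℤ} (hhead : b 0 = b' 0) {w : ZQ Q}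
    (hw : IsUnit w) (s₁ : Fin (n + 1) → ZQ Q)
    (hs₁ : ∀ i, s₁ i = w * (((b' i : ℤ) : ZQ Q) - ((b i : ℤ) : ZQ Q))) :
    ((Nat.card (span Q (secretDiff n Q (Finset.univ.erase 0) 0 s₁)) : ℝ))⁻¹
      = ((Nat.card (span Q (dirDiffQ n Q b b')) : ℝ))⁻¹ := by
  classical
  have hiff : ∀ σ : ZQ Q,
      (∀ i : ↥(Finset.univ.erase (0 : Fin (n + 1))),
          σ * secretDiff n Q (Finset.univ.erase 0) 0 s₁ i = 0)
        ↔ ∀ i, σ * dirDiffQ n Q b b' i = 0 := by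
    intro σ
    simp only [secretDiff, Pi.zero_apply, sub_zero, hs₁, dirDiffQ, Int.cast_sub]
    constructor
    · intro h i
      by_cases hi : i = 0
      · subst hi
        rw [hhead, sub_self, mul_zero]
      · have h' := h ⟨i, Finset.mem_erase.2 ⟨hi, Finset.mem_univ _⟩⟩
        rw [mul_left_comm] at h'
        have h'' := hw.mul_right_eq_zero.1 h'
        linear_combination (-1 : ZQ Q) * h''
    · rintro h ⟨i, hi⟩
      linear_combination (-w) * h i
  rw [inv_card_span_eq, inv_card_span_eq, Nat.card_congr (Equiv.subtypeEquivRight hiff)]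

/-- **THE TWO-DIRECTION LAW FOR GENERAL MEASUREMENTS (T30; census §38).**  For `P = p₁Q` odd, `2D²p₁`
a unit mod `Q`, two head-`(−1)` directions `b, b′` and EVERY POVM `E` on the Step-8 register with
outcomes in `ℤ_Q`:  `P̄_E(b) + P̄_E(b′) ≤ 1 + 1/#span_Q(b − b′ mod Q)`.  In particular no measurement
reads the datum with probability close to `1` on (the offset-average of) two inequivalent classes;
the bound is attained (`dirSuccess_pair_isGreatest`).  It does NOT bear on reading the datum of ONE
class (T18: certain) nor on Step 9's offset problem (§0).
[cite: ChenQuantumLattice2024, §3.5.9 pp. 35–37, Lemma 2.12 p. 12; NielsenChuang2010, §2.2.6 p. 90] -/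
theorem dirSuccess_add_le (hP : Odd ((p₁ * Q : ℕ+) : ℕ)) {b b' : Fin (n + 1) → ℤ}
    (hb : b 0 = -1) (hb' : b' 0 = -1) (hunit : IsUnit ((2 * D * D * p₁ : ℕ) : ZQ Q))
    (E : POVM (Fin (n + 1) → ZN D p₁ Q) (ZQ Q)) :
    dirSuccess n D p₁ Q b E + dirSuccess n D p₁ Q b' E
      ≤ 1 + ((Nat.card (span Q (dirDiffQ n Q b b')) : ℝ))⁻¹ := by
  classical
  -- units mod `Q` out of `2D²p₁`
  have hp₁ : IsUnit ((((p₁ : ℕ+) : ℕ) : ZQ Q)) := by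
    have hu := hunit
    rw [Nat.cast_mul] at hu
    exact isUnit_of_mul_isUnit_right hu
  have hκ : IsUnit (((D * D * p₁ : ℕ)) : ZQ Q) := by
    have hu := hunit
    rw [show (2 * D * D * p₁ : ℕ) = 2 * (D * D * p₁ : ℕ) by ring, Nat.cast_mul] at hu
    exact isUnit_of_mul_isUnit_right hu
  have h2p : IsUnit (((2 * p₁ : ℕ)) : ZQ Q) := by
    have hu := hunit
    rw [show (2 * D * D * p₁ : ℕ) = (2 * p₁ : ℕ) * (D * D : ℕ) by ring, Nat.cast_mul] at hu
    exact isUnit_of_mul_isUnit_left hu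
  -- a representative `b̃ ≡ b (mod Q)` with head `−1` and `p₁ ∣ b̃_i (i ≥ 1)`
  obtain ⟨xinv, hx⟩ : ∃ x : ℤ, (((p₁ : ℕ+) : ℕ) : ZQ Q) * ((x : ℤ) : ZQ Q) = 1 :=
    ⟨((((((p₁ : ℕ+) : ℕ) : ZQ Q))⁻¹).val : ℤ), by
      rw [Int.cast_natCast, ZMod.natCast_zmod_val, ZMod.mul_inv_of_unit _ hp₁]⟩
  set bt : Fin (n + 1) → ℤ :=
    fun i => if i = 0 then -1 else (((p₁ : ℕ+) : ℕ) : ℤ) * (xinv * b i) with hbt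
  have hbt0 : bt 0 = -1 := by simp [hbt]
  have hbtp : ∀ i, i ≠ 0 → (((p₁ : ℕ+) : ℕ) : ℤ) ∣ bt i := fun i hi => by
    simp only [hbt, if_neg hi]
    exact dvd_mul_right _ _
  have hmod : ∀ i, ((b i : ℤ) : ZQ Q) = ((bt i : ℤ) : ZQ Q) := by
    intro i
    by_cases hi : i = 0
    · rw [hi, hb, hbt0]
    · simp only [hbt, if_neg hi]
      push_cast
      rw [← mul_assoc, hx, one_mul]
  -- the secret `s₁ = (2p₁)⁻¹(b′ − b)` taking `b̃` to `b′ mod Q`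
  obtain ⟨w, hw⟩ := h2p.exists_left_inv
  push_cast at hw
  set s₁ : Fin (n + 1) → ZQ Q := fun i => w * (((b' i : ℤ) : ZQ Q) - ((b i : ℤ) : ZQ Q)) with hs₁
  have hshift0 : ∀ s : Fin (n + 1) → ZQ Q, secretShift n p₁ Q (Finset.univ.erase 0) s 0 = 0 := by
    intro s
    simp [secretShift, classTail]
  have hmod' : ∀ i, ((b' i : ℤ) : ZQ Q)
      = (((bt + secretShift n p₁ Q (Finset.univ.erase 0) s₁) i : ℤ) : ZQ Q) := by
    intro i
    rw [Pi.add_apply, Int.cast_add, ← hmod i]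
    by_cases hi : i = 0
    · rw [hi, hshift0, hb, hb']
      push_cast
      ring
    · have hiU : i ∈ Finset.univ.erase (0 : Fin (n + 1)) :=
        Finset.mem_erase.2 ⟨hi, Finset.mem_univ _⟩
      simp only [secretShift, classTail, if_pos hiU, hs₁]
      push_cast
      rw [ZMod.natCast_zmod_val]
      linear_combination (((b i : ℤ) : ZQ Q) - ((b' i : ℤ) : ZQ Q)) * hw
  -- the averaged two-class law for `Ê`, `b̃`, secrets `0` and `s₁`
  have hlaw := fourier_secret_pair_le n D p₁ Q hP hbt0 hbtp hκ E.fourierConj 0 s₁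
  have hs0 : bt + secretShift n p₁ Q (Finset.univ.erase 0) 0 = bt := by
    funext i
    simp [secretShift, classTail]
  rw [hs0] at hlaw
  -- Fourier sums are `N^{n+1}` × position sums; then the congruences `b̃ ≡ b`, `b̃ + 2p₁s₁ ≡ b′`
  simp only [POVM.fourierConj_weight, ← Finset.mul_sum] at hlaw
  rw [← sum_weight_congr_mod n D p₁ Q hmod E, ← sum_weight_congr_mod n D p₁ Q hmod' E,
    inv_card_span_secretDiff_eq n Q (hb.trans hb'.symm) (IsUnit.of_mul_eq_one _ hw) s₁
      (fun i => rfl)] at hlaw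
  have hNc : ((((D * D * (p₁ * Q) : ℕ+) : ℕ) : ℂ)) ^ (n + 1)
      = (((((D * D * (p₁ * Q) : ℕ+) : ℕ) : ℝ) ^ (n + 1) : ℝ) : ℂ) := by push_cast; rfl
  rw [hNc, Complex.re_ofReal_mul, Complex.re_ofReal_mul] at hlaw
  -- divide by the total weights
  have hN : (0 : ℝ) < ((((D * D * (p₁ * Q) : ℕ+) : ℕ) : ℝ)) ^ (n + 1) := by positivity
  have hP0 : (0 : ℝ) < (((p₁ * Q : ℕ+) : ℕ) : ℝ) := by exact_mod_cast PNat.pos _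
  unfold dirSuccess
  rw [dir_totalWeight n D p₁ Q hP b, dir_totalWeight n D p₁ Q hP b', ← add_div,
    div_le_iff₀ (mul_pos hN hP0)]
  refine le_of_mul_le_mul_left ?_ hN
  calc ((((D * D * (p₁ * Q) : ℕ+) : ℕ) : ℝ)) ^ (n + 1) * (_ + _)
      = _ := by rw [mul_add]
    _ ≤ _ := hlaw
    _ = _ := by ring

/-- **Two directions in the same class mod `Q` have the same offset-averaged success** (any POVM).
[cite: ChenQuantumLattice2024, §3.5.9 pp. 35–37] -/
theorem dirSuccess_eq_of_dirDiffQ_eq_zero (hP : Odd ((p₁ * Q : ℕ+) : ℕ)) {b b' : Fin (n + 1) → ℤ}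
    (hδ : dirDiffQ n Q b b' = 0) (E : POVM (Fin (n + 1) → ZN D p₁ Q) (ZQ Q)) :
    dirSuccess n D p₁ Q b E = dirSuccess n D p₁ Q b' E :=
  dirSuccess_congr_mod n D p₁ Q hP (fun i => by
    have h := congr_fun hδ i
    simp only [dirDiffQ, Pi.zero_apply, Int.cast_sub, sub_eq_zero] at h
    exact h) E

/-- **Attainment, part 1 (T18).**  The datum reader of `b` has `P̄(b) = 1`.
[cite: ChenQuantumLattice2024, §3.5.9 pp. 35–37; NielsenChuang2010, §2.2.6 p. 90] -/
theorem dirSuccess_datumReader_self (hP : Odd ((p₁ * Q : ℕ+) : ℕ)) {b : Fin (n + 1) → ℤ}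
    (hb : b 0 = -1) : dirSuccess n D p₁ Q b (datumReader n D p₁ Q b hP hb) = 1 := by
  unfold dirSuccess
  have h : ∀ u : Fin (n + 1) → ZN D p₁ Q,
      (datumReader n D p₁ Q b hP hb).weight (phi8bKet n D p₁ Q b (liftV n D p₁ Q u))
          (toDatum D p₁ Q (u 0))
        = star (phi8bKet n D p₁ Q b (liftV n D p₁ Q u)) ⬝ᵥ phi8bKet n D p₁ Q b (liftV n D p₁ Q u) := by
    intro u
    have hc := datumReader_certain n D p₁ Q b hP hb (liftV n D p₁ Q u)
    rw [intCast_liftV] at hc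
    exact hc
  simp only [h]
  exact div_self (dir_totalWeight_pos n D p₁ Q hP b).ne'

/-- **Attainment, part 2 (T20).**  The datum reader of `b` has `P̄(b′) = 1/#span_Q(b − b′ mod Q)` on
every other head-`(−1)` direction `b′`. [cite: ChenQuantumLattice2024, §3.5.9 pp. 35–37; NielsenChuang2010, §2.2.6 p. 90] -/
theorem dirSuccess_datumReader_cross (hP : Odd ((p₁ * Q : ℕ+) : ℕ)) {b b' : Fin (n + 1) → ℤ}
    (hb : b 0 = -1) (hb' : b' 0 = -1) (hunit : IsUnit ((2 * D * D * p₁ : ℕ) : ZQ Q)) :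
    dirSuccess n D p₁ Q b' (datumReader n D p₁ Q b hP hb)
      = ((Nat.card (span Q (dirDiffQ n Q b b')) : ℝ))⁻¹ := by
  unfold dirSuccess
  have hPpos : (0 : ℝ) < (((p₁ * Q : ℕ+) : ℕ) : ℝ) := by exact_mod_cast PNat.pos _
  have hnorm : ∀ u : Fin (n + 1) → ZN D p₁ Q,
      (star (phi8bKet n D p₁ Q b' (liftV n D p₁ Q u))
          ⬝ᵥ phi8bKet n D p₁ Q b' (liftV n D p₁ Q u)).re = (((p₁ * Q : ℕ+) : ℕ) : ℝ) := by
    intro u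
    rw [phi8bKet_normSq_of_odd n D p₁ Q hP]
    exact Complex.natCast_re _
  have h : ∀ u : Fin (n + 1) → ZN D p₁ Q,
      ((datumReader n D p₁ Q b hP hb).weight (phi8bKet n D p₁ Q b' (liftV n D p₁ Q u))
          (toDatum D p₁ Q (u 0))).re
        = ((Nat.card (span Q (dirDiffQ n Q b b')) : ℝ))⁻¹ * (((p₁ * Q : ℕ+) : ℕ) : ℝ) := by
    intro u
    have hc := datumReader_cross_prob n D p₁ Q b hP hb b' hb' hunit (liftV n D p₁ Q u)
    rw [intCast_liftV, hnorm u, div_eq_iff hPpos.ne'] at hc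
    exact hc
  have hcard : (0 : ℝ) < (Fintype.card (Fin (n + 1) → ZN D p₁ Q) : ℝ) := by
    exact_mod_cast Fintype.card_pos
  rw [Complex.re_sum, Complex.re_sum]
  simp only [h, hnorm, Finset.sum_const, Finset.card_univ, nsmul_eq_mul]
  rw [mul_left_comm, mul_div_assoc, div_self (mul_pos hcard hPpos).ne', mul_one]

/-- **T30 is sharp**: `1 + 1/#span_Q(b − b′)` is the MAXIMUM of `P̄_E(b) + P̄_E(b′)` over all POVMs
`E`, attained by Chen's datum reader of `b`. [cite: ChenQuantumLattice2024, §3.5.9 pp. 35–37; NielsenChuang2010, §2.2.6 p. 90] -/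
theorem dirSuccess_pair_isGreatest (hP : Odd ((p₁ * Q : ℕ+) : ℕ)) {b b' : Fin (n + 1) → ℤ}
    (hb : b 0 = -1) (hb' : b' 0 = -1) (hunit : IsUnit ((2 * D * D * p₁ : ℕ) : ZQ Q)) :
    IsGreatest {x : ℝ | ∃ E : POVM (Fin (n + 1) → ZN D p₁ Q) (ZQ Q),
        x = dirSuccess n D p₁ Q b E + dirSuccess n D p₁ Q b' E}
      (1 + ((Nat.card (span Q (dirDiffQ n Q b b')) : ℝ))⁻¹) := by
  refine ⟨⟨datumReader n D p₁ Q b hP hb, ?_⟩, ?_⟩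
  · rw [dirSuccess_datumReader_self n D p₁ Q hP hb,
      dirSuccess_datumReader_cross n D p₁ Q hP hb hb' hunit]
  · rintro x ⟨E, rfl⟩
    exact dirSuccess_add_le n D p₁ Q hP hb hb' hunit E

/-- **Trade-off**: `(1 − ε)`-success on `b` caps the success on `b′` at `1/#span_Q(b − b′) + ε`.
[cite: ChenQuantumLattice2024, §3.5.9 pp. 35–37; NielsenChuang2010, §2.2.6 p. 90] -/
theorem dirSuccess_le_of_le (hP : Odd ((p₁ * Q : ℕ+) : ℕ)) {b b' : Fin (n + 1) → ℤ}
    (hb : b 0 = -1) (hb' : b' 0 = -1) (hunit : IsUnit ((2 * D * D * p₁ : ℕ) : ZQ Q))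
    (E : POVM (Fin (n + 1) → ZN D p₁ Q) (ZQ Q)) {ε : ℝ} (h₀ : 1 - ε ≤ dirSuccess n D p₁ Q b E) :
    dirSuccess n D p₁ Q b' E ≤ ((Nat.card (span Q (dirDiffQ n Q b b')) : ℝ))⁻¹ + ε := by
  have h := dirSuccess_add_le n D p₁ Q hP hb hb' hunit E
  linarith

/-- **Tolerance floor**: `(1 − ε)`-success on both `b` and `b′` forces `ε ≥ (1 − 1/#span_Q(b − b′))/2`.
[cite: ChenQuantumLattice2024, §3.5.9 pp. 35–37; NielsenChuang2010, §2.2.6 p. 90] -/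
theorem half_defect_le_eps (hP : Odd ((p₁ * Q : ℕ+) : ℕ)) {b b' : Fin (n + 1) → ℤ}
    (hb : b 0 = -1) (hb' : b' 0 = -1) (hunit : IsUnit ((2 * D * D * p₁ : ℕ) : ZQ Q))
    (E : POVM (Fin (n + 1) → ZN D p₁ Q) (ZQ Q)) {ε : ℝ} (h₀ : 1 - ε ≤ dirSuccess n D p₁ Q b E)
    (h₁ : 1 - ε ≤ dirSuccess n D p₁ Q b' E) :
    (1 - ((Nat.card (span Q (dirDiffQ n Q b b')) : ℝ))⁻¹) / 2 ≤ ε := by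
  have h := dirSuccess_add_le n D p₁ Q hP hb hb' hunit E
  linarith

/-- **The constant tolerance (census §38, answering REFEREE R-74.2).**  If `b ≢ b′ (mod Q)` then
`(1 − ε)`-success on both forces `ε ≥ (1 − 1/minFac Q)/2 ≥ 1/3` — for EVERY POVM, with no
perturbative hypothesis (compare T29: `4εP² < 1`). [cite: ChenQuantumLattice2024, §3.5.9 pp. 35–37; NielsenChuang2010, §2.2.6 p. 90] -/
theorem eps_floor_of_dirDiffQ_ne_zero (hP : Odd ((p₁ * Q : ℕ+) : ℕ)) {b b' : Fin (n + 1) → ℤ}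
    (hb : b 0 = -1) (hb' : b' 0 = -1) (hunit : IsUnit ((2 * D * D * p₁ : ℕ) : ZQ Q))
    (hδ : dirDiffQ n Q b b' ≠ 0) (E : POVM (Fin (n + 1) → ZN D p₁ Q) (ZQ Q)) {ε : ℝ}
    (h₀ : 1 - ε ≤ dirSuccess n D p₁ Q b E) (h₁ : 1 - ε ≤ dirSuccess n D p₁ Q b' E) :
    (1 - ((((Q : ℕ+) : ℕ).minFac : ℝ))⁻¹) / 2 ≤ ε ∧ (1 : ℝ) / 3 ≤ ε := by
  classical
  have h := dirSuccess_add_le n D p₁ Q hP hb hb' hunit E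
  have hS3 : (3 : ℝ) ≤ Nat.card (span Q (dirDiffQ n Q b b')) := by
    exact_mod_cast three_le_card_span Q (odd_Q_of_odd_P p₁ Q hP) hδ
  have hmf : ((((Q : ℕ+) : ℕ).minFac : ℝ)) ≤ Nat.card (span Q (dirDiffQ n Q b b')) := by
    exact_mod_cast minFac_le_card_span Q hδ
  have hmfpos : (0 : ℝ) < ((Q : ℕ+) : ℕ).minFac := by exact_mod_cast Nat.minFac_pos _
  have hinv3 : ((Nat.card (span Q (dirDiffQ n Q b b')) : ℝ))⁻¹ ≤ 1 / 3 := by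
    rw [one_div]
    exact inv_anti₀ (by norm_num) hS3
  have hinvm : ((Nat.card (span Q (dirDiffQ n Q b b')) : ℝ))⁻¹ ≤ ((((Q : ℕ+) : ℕ).minFac : ℝ))⁻¹ :=
    inv_anti₀ hmfpos hmf
  constructor <;> linarith

/-- **No measurement beats `2/3` on two inequivalent classes** (offset-averaged).
[cite: ChenQuantumLattice2024, §3.5.9 pp. 35–37; NielsenChuang2010, §2.2.6 p. 90] -/
theorem not_both_gt_two_thirds (hP : Odd ((p₁ * Q : ℕ+) : ℕ)) {b b' : Fin (n + 1) → ℤ}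
    (hb : b 0 = -1) (hb' : b' 0 = -1) (hunit : IsUnit ((2 * D * D * p₁ : ℕ) : ZQ Q))
    (hδ : dirDiffQ n Q b b' ≠ 0) (E : POVM (Fin (n + 1) → ZN D p₁ Q) (ZQ Q)) :
    ¬ (2 / 3 < dirSuccess n D p₁ Q b E ∧ 2 / 3 < dirSuccess n D p₁ Q b' E) := by
  classical
  rintro ⟨h₀, h₁⟩
  have h := dirSuccess_add_le n D p₁ Q hP hb hb' hunit E
  have hS3 : (3 : ℝ) ≤ Nat.card (span Q (dirDiffQ n Q b b')) := by
    exact_mod_cast three_le_card_span Q (odd_Q_of_odd_P p₁ Q hP) hδ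
  have hinv3 : ((Nat.card (span Q (dirDiffQ n Q b b')) : ℝ))⁻¹ ≤ 1 / 3 := by
    rw [one_div]
    exact inv_anti₀ (by norm_num) hS3
  linarith

end Law

end Literature.Computability.Cryptography.Chen2024

/-! ### 6. For admissible shapes -/

namespace Literature.Computability.Cryptography.Chen2024.Shape

open Literature.Computability.Cryptography.Chen2024

variable (S : Shape)

/-- **T30 for admissible shapes (census §38).**  For every POVM `E` and every head-`(−1)` rival `b′`:
`P̄_E(S.b) + P̄_E(b′) ≤ 1 + 1/#span_Q(S.b − b′ mod Q)`. [cite: ChenQuantumLattice2024, §3.5.9 pp. 35–37; NielsenChuang2010, §2.2.6 p. 90] -/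
theorem dirSuccess_add_le (h : S.Admissible) {b' : Fin (S.n + 1) → ℤ} (hb' : b' 0 = -1)
    (E : POVM (Fin (S.n + 1) → ZN S.D S.p₁ S.Q) (ZQ S.Q)) :
    Chen2024.dirSuccess S.n S.D S.p₁ S.Q S.b E + Chen2024.dirSuccess S.n S.D S.p₁ S.Q b' E
      ≤ 1 + ((Nat.card (span S.Q (dirDiffQ S.n S.Q S.b b')) : ℝ))⁻¹ :=
  Chen2024.dirSuccess_add_le S.n S.D S.p₁ S.Q h.odd_P h.b_head hb' h.isUnit_twoDDp₁_modQ E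

/-- **T30's tolerance floor for admissible shapes**: a POVM `(1 − ε)`-successful on `S.b` and on a
rival `b′ ≢ S.b (mod Q)` has `ε ≥ 1/3`. [cite: ChenQuantumLattice2024, §3.5.9 pp. 35–37; NielsenChuang2010, §2.2.6 p. 90] -/
theorem eps_floor_of_dirDiffQ_ne_zero (h : S.Admissible) {b' : Fin (S.n + 1) → ℤ} (hb' : b' 0 = -1)
    (hδ : dirDiffQ S.n S.Q S.b b' ≠ 0) (E : POVM (Fin (S.n + 1) → ZN S.D S.p₁ S.Q) (ZQ S.Q)) {ε : ℝ}
    (h₀ : 1 - ε ≤ Chen2024.dirSuccess S.n S.D S.p₁ S.Q S.b E)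
    (h₁ : 1 - ε ≤ Chen2024.dirSuccess S.n S.D S.p₁ S.Q b' E) :
    (1 - ((((S.Q : ℕ+) : ℕ).minFac : ℝ))⁻¹) / 2 ≤ ε ∧ (1 : ℝ) / 3 ≤ ε :=
  Chen2024.eps_floor_of_dirDiffQ_ne_zero S.n S.D S.p₁ S.Q h.odd_P h.b_head hb'
    h.isUnit_twoDDp₁_modQ hδ E h₀ h₁

end Literature.Computability.Cryptography.Chen2024.Shape
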